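import Literature.AlgebraicTopology.SingularHomology.RelativeEilenbergRetraction
import Literature.AlgebraicTopology.SingularHomology.RelativeEilenbergDeformation
import HarnessLib

/-!
# Existence of relative Eilenberg retractions (discharge of `nonempty_relEilenbergRetraction`)

Topic `Literature/AlgebraicTopology/SingularHomology`, sibling proof file of
`RelativeEilenbergRetraction.lean`. E. H. Spanier, *Algebraic Topology* (1966; Springer 1981),
Ch. 7 §4, proof of **Theorem 8** (p. 393 of the held copy), for a pair `(X, A)` which is
`m`-connected with `X` and `A` path connected: to every singular simplex `σ : Δ^q → X` a homotopy
`P(σ) : Δ^q × I → X` is assigned, by induction on `q`, with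

* (a) `P(σ)(z, 0) = σ(z)`;
* (b) `σ̄ := P(σ)(·, 1)` lies in the subcomplex `Δ(X, A, x₀)ᵐ` (vertices to `x₀`, `m`-skeleton
  into `A`), and `P(σ) = σ ∘ pr₁` is constant when `σ` already does ("if `σ` is in `Δ(X, A, x₀)ⁿ`,
  define `P(σ) = σ ∘ p`");
* (c) `P(σ) ∘ (e^i_q × 1) = P(σ⁽ⁱ⁾)`;

and, as the bookkeeping that the relative Hurewicz argument needs (`RelativeEilenbergRetraction.lean`),

* (A) `P(σ) ⊆ A` whenever `σ ⊆ A` (the construction run inside `A`: Spanier's use of the case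
  `(A, {x₀})`, `n = 0`, in Cor. 7.4.9),
* a stationary time profile (`P(σ)` constant in time from `τ_q = 1 - 2^{-(q+1)}` on,
  `WhiteheadCW.tau`), which is what lets the compressions of the next dimension take place after
  the sides have stopped moving (`RelativeCompression.exists_fill_into`).

Spanier's three cases, plus (A): `q = 0` — a path to `x₀`, inside `A` for points of `A`, constant
at `x₀` (`exists_level_zero`); `0 < q ≤ m`, `σ ∉` subcomplex, `σ ⊄ A` — fill the prism from the
bottom `σ` and the sides `P(σ⁽ⁱ⁾)` with the lid in `A`, using `π_q(X, A, ·) = 0`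
(`RelativeCompression.exists_fill_into`, `Homotopy/RelativeCompression.lean`); `σ ⊆ A`, `σ ∉`
subcomplex — any stationary filling *inside the subspace `A`*
(`RelativeCompression.exists_fill_stationary` in `↥A`), whose lid has its vertices at `x₀` because
they lie on the faces; `q > m` — any stationary filling, (b) being automatic because the
`m`-skeleton of `Δ^q` then lies in `∂Δ^q` (all in `exists_level_succ`). The prescribed face data
glue along codimension-two faces by the simplicial identity
(`EilenbergRetraction.compatible_faces_succ` / `compatible_faces_zero`, `EilenbergRetractionProofs.lean`,
whose `C(Δ^k × I, X)` model is shared, as in `RelativeEilenbergDeformation.lean`). Choosing a level at a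
time (recursion on `q`) gives the tower, whose end maps `σ ↦ σ̄` form a
`RelEilenbergRetraction X A x₀ m`: **`nonempty_relEilenbergRetraction_holds`**.

Everything here is proved; the file declares no definitions besides the `Prop`-valued bundle
`RelEilenbergRetraction.LevelGood` of the properties (a), (b), (A), stationarity and compatibility.

## References

* E. H. Spanier, *Algebraic Topology*, Springer (1981), Ch. 7 §4, Lemma 7 and Theorem 8
  (pp. 392–393), Corollary 9. [Spanier1981]
* A. Hatcher, *Algebraic Topology*, CUP (2002), Prop. 0.16, §4.1 Lemma 4.7. [HatcherAT2002]
-/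

noncomputable section

open Set Function
open scoped unitInterval Topology
open Literature.AlgebraicTopology.Homotopy
open Literature.AlgebraicTopology.Homotopy.WhiteheadCW (tau tau_pos tau_lt_one tau_le_one tau_lt_succ)

universe u

namespace Literature.AlgebraicTopology.SingularHomology

open SingularSimplex

variable {X : Type u} [TopologicalSpace X]

namespace RelEilenbergRetraction

/-! ### The properties of one level of the tower -/

/-- **The properties of the homotopies `P(σ)` of the `q`-simplices** (Spanier 1981, Ch. 7 §4,
Lemma 7 (a), (b) and the proof of Thm. 8, relative version with the bookkeeping of this file):
(a) start at the simplex; (b) end with the vertices at `x₀` and the `m`-skeleton in `A`, constant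
on relative Eilenberg simplices; (A) inside `A` for simplices of `A`; stationary from time `τ_q`
on; compatible faces over every `(q+1)`-simplex. [cite: Spanier1981, Ch. 7 §4 Lemma 7] -/
structure LevelGood (A : Set X) (x₀ : X) (m q : ℕ)
    (P : SingularSimplex X q → C(StdSimplex q × I, X)) : Prop where
  /-- (a) the homotopy starts at the simplex -/
  bot : ∀ (η : SingularSimplex X q) (t : StdSimplex q), P η (t, 0) = toContinuousMap η t
  /-- (b) the end map sends every vertex to `x₀` -/
  vert : ∀ (η : SingularSimplex X q) (i : Fin (q + 1)), P η (stdSimplex.vertex (S := ℝ) i, 1) = x₀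
  /-- (b) the end map sends the `m`-skeleton into `A` -/
  skel : ∀ (η : SingularSimplex X q), ∀ t ∈ stdSkel q m, P η (t, 1) ∈ A
  /-- (b) the homotopy is constant on relative Eilenberg simplices -/
  const : ∀ (η : SingularSimplex X q), IsRelEilenberg A x₀ m η →
    ∀ (t : StdSimplex q) (s : I), P η (t, s) = toContinuousMap η t
  /-- (A) the homotopy stays in `A` for simplices of `A` -/
  inA : ∀ (η : SingularSimplex X q), η.range ⊆ A → ∀ (t : StdSimplex q) (s : I), P η (t, s) ∈ A
  /-- stationary from time `τ_q` on -/
  stat : ∀ (η : SingularSimplex X q) (t : StdSimplex q) (s : I), tau q ≤ (s : ℝ) → P η (t, s) = P η (t, 1)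
  /-- the face homotopies of every `(q+1)`-simplex are compatible -/
  compat : ∀ τ : SingularSimplex X (q + 1), SimplexPrism.Compatible fun i => P (τ.face i)

variable {A : Set X} {x₀ : X} {m : ℕ}

/-! ### Level zero -/

open Classical in
/-- The path assigned to a point `x`: constant at `x₀` if `x = x₀`, a path inside `A` from `x` to
`x₀` if `x ∈ A` (`A` path connected), any path from `x` to `x₀` otherwise (`X` path connected);
run at double speed and then stationary (Spanier 1981, p. 393, case `q = 0`). [cite: Spanier1981, Ch. 7 §4 Thm. 8] -/
def levelZeroPath [PathConnectedSpace X] (A : Set X) [PathConnectedSpace A] (x₀ : A) (x : X) : C(I, X) :=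
  if x = (x₀ : X) then ContinuousMap.const I (x₀ : X)
  else if hx : x ∈ A then
    ((PathConnectedSpace.somePath (⟨x, hx⟩ : A) x₀).map continuous_subtype_val).toContinuousMap.comp
      ⟨RelativeCompression.affTime 0 (1 / 2), RelativeCompression.continuous_affTime 0 (1 / 2)⟩
  else (PathConnectedSpace.somePath x (x₀ : X)).toContinuousMap.comp
      ⟨RelativeCompression.affTime 0 (1 / 2), RelativeCompression.continuous_affTime 0 (1 / 2)⟩

section Zero

variable [PathConnectedSpace X] [PathConnectedSpace A] (x₀ : A)

/-- The path starts at `x`. [folklore] -/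
lemma levelZeroPath_zero (x : X) : levelZeroPath A x₀ x 0 = x := by
  unfold levelZeroPath
  split_ifs with h hx
  · exact h.symm
  · show ((PathConnectedSpace.somePath (⟨x, hx⟩ : A) x₀).map continuous_subtype_val)
      (RelativeCompression.affTime 0 (1 / 2) 0) = x
    rw [RelativeCompression.affTime_self 0 (1 / 2) 0 rfl]
    exact ((PathConnectedSpace.somePath (⟨x, hx⟩ : A) x₀).map continuous_subtype_val).source
  · show (PathConnectedSpace.somePath x (x₀ : X)) (RelativeCompression.affTime 0 (1 / 2) 0) = x
    rw [RelativeCompression.affTime_self 0 (1 / 2) 0 rfl]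
    exact (PathConnectedSpace.somePath x (x₀ : X)).source

/-- The path is stationary from time `1/2` on. [folklore] -/
lemma levelZeroPath_of_half_le (x : X) (s : I) (hs : 1 / 2 ≤ (s : ℝ)) :
    levelZeroPath A x₀ x s = levelZeroPath A x₀ x 1 := by
  have h1 : RelativeCompression.affTime 0 (1 / 2) s = 1 :=
    RelativeCompression.affTime_eq_one 0 (1 / 2) one_half_pos s (by linarith)
  have h2 : RelativeCompression.affTime 0 (1 / 2) 1 = 1 :=
    RelativeCompression.affTime_eq_one 0 (1 / 2) one_half_pos 1 (by norm_num)
  unfold levelZeroPath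
  split_ifs with h hx
  · rfl
  · show ((PathConnectedSpace.somePath (⟨x, hx⟩ : A) x₀).map continuous_subtype_val)
        (RelativeCompression.affTime 0 (1 / 2) s) =
      ((PathConnectedSpace.somePath (⟨x, hx⟩ : A) x₀).map continuous_subtype_val)
        (RelativeCompression.affTime 0 (1 / 2) 1)
    rw [h1, h2]
  · show (PathConnectedSpace.somePath x (x₀ : X)) (RelativeCompression.affTime 0 (1 / 2) s) =
      (PathConnectedSpace.somePath x (x₀ : X)) (RelativeCompression.affTime 0 (1 / 2) 1)
    rw [h1, h2]

/-- The path ends at `x₀`. [folklore] -/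
lemma levelZeroPath_one (x : X) : levelZeroPath A x₀ x 1 = x₀ := by
  have h2 : RelativeCompression.affTime 0 (1 / 2) 1 = 1 :=
    RelativeCompression.affTime_eq_one 0 (1 / 2) one_half_pos 1 (by norm_num)
  unfold levelZeroPath
  split_ifs with h hx
  · rfl
  · show ((PathConnectedSpace.somePath (⟨x, hx⟩ : A) x₀).map continuous_subtype_val)
        (RelativeCompression.affTime 0 (1 / 2) 1) = x₀
    rw [h2]
    exact ((PathConnectedSpace.somePath (⟨x, hx⟩ : A) x₀).map continuous_subtype_val).target
  · show (PathConnectedSpace.somePath x (x₀ : X)) (RelativeCompression.affTime 0 (1 / 2) 1) = x₀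
    rw [h2]
    exact (PathConnectedSpace.somePath x (x₀ : X)).target

/-- The path of `x₀` itself is constant. [folklore] -/
lemma levelZeroPath_self (s : I) : levelZeroPath A x₀ (x₀ : X) s = x₀ := by
  unfold levelZeroPath
  rw [if_pos rfl]
  rfl

/-- The path of a point of `A` stays in `A`. [folklore] -/
lemma levelZeroPath_mem {x : X} (hx : x ∈ A) (s : I) : levelZeroPath A x₀ x s ∈ A := by
  unfold levelZeroPath
  split_ifs with h
  · exact x₀.2
  · exact (PathConnectedSpace.somePath (⟨x, hx⟩ : A) x₀ _).2

/-- **Level `0`** (Spanier p. 393, case `q = 0`, with the bookkeeping of this file): to every point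
a homotopy `Δ⁰ × I → X` from it to `x₀`, constant at `x₀`, inside `A` for points of `A`,
stationary from `τ₀ = 1/2` on; the face data it prescribes over `1`-simplices are compatible.
[cite: Spanier1981, Ch. 7 §4 Thm. 8] -/
theorem exists_level_zero (m : ℕ) :
    ∃ P : SingularSimplex X 0 → C(StdSimplex 0 × I, X), LevelGood A (x₀ : X) m 0 P := by
  let P : SingularSimplex X 0 → C(StdSimplex 0 × I, X) := fun ρ =>
    (levelZeroPath A x₀ (toContinuousMap ρ (Classical.arbitrary _))).comp ContinuousMap.snd
  have hP : ∀ (ρ : SingularSimplex X 0) (t : StdSimplex 0) (s : I),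
      P ρ (t, s) = levelZeroPath A x₀ (toContinuousMap ρ (Classical.arbitrary _)) s := fun _ _ _ => rfl
  have ht : ∀ t : StdSimplex 0, t = Classical.arbitrary _ := fun t =>
    Subsingleton.elim (α := stdSimplex ℝ (Fin 1)) t _
  refine ⟨P, ⟨fun ρ t => ?_, fun ρ i => ?_, fun ρ t _ => ?_, fun ρ hρ t s => ?_, fun ρ hρ t s => ?_,
    fun ρ t s hs => ?_, fun τ => EilenbergRetraction.compatible_faces_zero P τ⟩⟩
  · rw [hP, levelZeroPath_zero, ← ht t]
  · rw [hP, levelZeroPath_one]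
  · rw [hP, levelZeroPath_one]; exact x₀.2
  · have h0 : toContinuousMap ρ (Classical.arbitrary _) = x₀ := by
      rw [← ht (stdSimplex.vertex (S := ℝ) (0 : Fin 1))]; exact hρ.2 0
    rw [hP, h0, levelZeroPath_self, ← h0, ← ht t]
  · rw [hP]; exact levelZeroPath_mem x₀ (hρ ⟨_, rfl⟩) s
  · rw [hP, hP, levelZeroPath_of_half_le x₀ _ s (by rw [RelativeDeformation.tau_zero] at hs; exact hs)]

end Zero

/-! ### The inductive step -/

/-- A vertex of `Δ^{q+1}` lies on a facet: `vᵢ = δⱼ(v_l)` for any `j ≠ i` (with `j.succAbove l = i`).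
[folklore] -/
lemma exists_vertex_eq_stdFace {q : ℕ} (i : Fin (q + 2)) :
    ∃ (j : Fin (q + 2)) (l : Fin (q + 1)), stdFace j (stdSimplex.vertex (S := ℝ) l) = stdSimplex.vertex (S := ℝ) i := by
  obtain ⟨j, hj⟩ : ∃ j : Fin (q + 2), j ≠ i := exists_ne i
  obtain ⟨l, hl⟩ := Fin.exists_succAbove_eq hj.symm
  exact ⟨j, l, by rw [stdFace_apply, stdSimplex.map_vertex, hl]⟩

/-- **Level `q + 1` from level `q`** (Spanier p. 393, cases `0 < q ≤ n` and `q > n`, relative version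
with the bookkeeping (A)). Given homotopies `P` of the `q`-simplices with `LevelGood`, and given
`π_j(X, A, b) = 0` for `1 ≤ j ≤ m` and all `b`, there are homotopies `P'` of the `(q+1)`-simplices
with `LevelGood` restricting on the faces to `P` (c). Four cases for a simplex `σ`: relative
Eilenberg — the constant homotopy; `σ ⊆ A` — a stationary filling inside the subspace `A`
(`RelativeCompression.exists_fill_stationary`); `q + 1 ≤ m` — the prism filled with the lid in `A`
(`RelativeCompression.exists_fill_into`, where `π_{q+1}(X, A, ·) = 0` enters); `q + 1 > m` — any
stationary filling, the end map then being relative Eilenberg because the `m`-skeleton of `Δ^{q+1}`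
lies in its boundary. In all cases the vertices of the lid are at `x₀` because they lie on the faces.
[cite: Spanier1981, Ch. 7 §4 Thm. 8] -/
theorem exists_level_succ {q : ℕ}
    (hπ : ∀ (j : ℕ) [NeZero j], j ≤ m → ∀ b : A, Subsingleton (RelHomotopyGroup.Pi j X A b))
    (P : SingularSimplex X q → C(StdSimplex q × I, X)) (hP : LevelGood A x₀ m q P) :
    ∃ P' : SingularSimplex X (q + 1) → C(StdSimplex (q + 1) × I, X),
      LevelGood A x₀ m (q + 1) P' ∧
      ∀ (η : SingularSimplex X (q + 1)) (i : Fin (q + 2)) (t : StdSimplex q) (s : I),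
        P' η (stdFace i t, s) = P (η.face i) (t, s) := by
  have hbot : ∀ (η : SingularSimplex X (q + 1)) (i : Fin (q + 2)) (t : StdSimplex q),
      P (η.face i) (t, 0) = toContinuousMap η (stdFace i t) := fun η i t => by
    rw [hP.bot, toContinuousMap_face_apply]
  have hstat : ∀ (η : SingularSimplex X (q + 1)) (i : Fin (q + 2)) (t : StdSimplex q) (s : I),
      tau q ≤ (s : ℝ) → P (η.face i) (t, s) = P (η.face i) (t, 1) := fun η i t s hs => hP.stat _ t s hs
  have htau : tau (q + 1) = (1 + tau q) / 2 := RelativeDeformation.tau_succ q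
  -- over every `(q+1)`-simplex a homotopy with (a), (c), stationarity, (b), constancy, (A)
  have key : ∀ η : SingularSimplex X (q + 1), ∃ G : C(StdSimplex (q + 1) × I, X),
      (∀ t, G (t, 0) = toContinuousMap η t) ∧
        (∀ (i : Fin (q + 2)) (t : StdSimplex q) (s : I), G (stdFace i t, s) = P (η.face i) (t, s)) ∧
        (∀ (t : StdSimplex (q + 1)) (s : I), tau (q + 1) ≤ (s : ℝ) → G (t, s) = G (t, 1)) ∧
        (∀ t ∈ stdSkel (q + 1) m, G (t, 1) ∈ A) ∧
        (IsRelEilenberg A x₀ m η → ∀ (t : StdSimplex (q + 1)) (s : I), G (t, s) = toContinuousMap η t) ∧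
        (η.range ⊆ A → ∀ (t : StdSimplex (q + 1)) (s : I), G (t, s) ∈ A) := by
    intro η
    by_cases hη : IsRelEilenberg A x₀ m η
    · -- "if `σ` is in `Δ(X, A, x₀)ⁿ`, define `P(σ) = σ ∘ p`"
      refine ⟨(toContinuousMap η).comp ContinuousMap.fst, fun t => rfl, fun i t s => ?_,
        fun t s _ => rfl, fun t ht => hη.1 t ht, fun _ t s => rfl, fun hA t s => hA ⟨t, rfl⟩⟩
      show toContinuousMap η (stdFace i t) = P (η.face i) (t, s)
      rw [hP.const _ (hη.face i), toContinuousMap_face_apply]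
    by_cases hA : η.range ⊆ A
    · -- `σ ⊆ A`: fill inside the subspace `A`
      have hfaceA : ∀ i : Fin (q + 2), (η.face i).range ⊆ A := fun i => (range_face_subset i η).trans hA
      let fA : C(StdSimplex (q + 1), A) :=
        ⟨fun t => ⟨toContinuousMap η t, hA ⟨t, rfl⟩⟩, (toContinuousMap η).continuous.subtype_mk _⟩
      let FA : Fin (q + 2) → C(StdSimplex q × I, A) := fun i =>
        ⟨fun p => ⟨P (η.face i) p, hP.inA _ (hfaceA i) p.1 p.2⟩, (P (η.face i)).continuous.subtype_mk _⟩
      have hFA : SimplexPrism.Compatible FA := fun i j t t' s h => Subtype.ext (hP.compat η i j t t' s h)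
      have hbotA : ∀ i t, FA i (t, 0) = fA (stdFace i t) := fun i t => Subtype.ext (hbot η i t)
      have hstatA : ∀ i t (s : I), tau q ≤ (s : ℝ) → FA i (t, s) = FA i (t, 1) :=
        fun i t s hs => Subtype.ext (hstat η i t s hs)
      obtain ⟨GA, hGA0, hGAs, hGAst⟩ :=
        RelativeCompression.exists_fill_stationary fA FA hFA hbotA (tau_pos q) (tau_le_one q) hstatA
      let G : C(StdSimplex (q + 1) × I, X) := ⟨fun p => (GA p : X), continuous_subtype_val.comp GA.continuous⟩
      have hG : ∀ p, G p = (GA p : X) := fun _ => rfl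
      have hGs : ∀ (i : Fin (q + 2)) (t : StdSimplex q) (s : I), G (stdFace i t, s) = P (η.face i) (t, s) :=
        fun i t s => by rw [hG, hGAs]; rfl
      refine ⟨G, fun t => by rw [hG, hGA0]; rfl, hGs, fun t s hs => ?_, fun t _ => (GA (t, 1)).2,
        fun h => absurd h hη, fun _ t s => (GA (t, s)).2⟩
      rw [hG, hG, hGAst t s ((tau_lt_succ q).le.trans hs)]
    by_cases hqm : q + 1 ≤ m
    · -- `0 < q + 1 ≤ m`: fill with the lid in `A`, using `π_{q+1}(X, A, ·) = 0`
      have hend : ∀ (i : Fin (q + 2)) (t : StdSimplex q), P (η.face i) (t, 1) ∈ A :=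
        fun i t => hP.skel _ t (by rw [stdSkel_eq_univ (show q ≤ m by omega)]; exact mem_univ _)
      obtain ⟨G, hG0, hGs, hGst, hG1⟩ := RelativeCompression.exists_fill_into (hπ (q + 1) hqm)
        (toContinuousMap η) (fun i => P (η.face i)) (hP.compat η) (hbot η) (tau_pos q) (tau_lt_one q)
        (hstat η) hend
      refine ⟨G, hG0, hGs, fun t s hs => hGst t s (by rw [htau] at hs; exact hs), fun t _ => hG1 t,
        fun h => absurd h hη, fun h => absurd h hA⟩
    · -- `q + 1 > m`: any stationary extension (homotopy extension property)
      obtain ⟨G, hG0, hGs, hGst⟩ := RelativeCompression.exists_fill_stationary (toContinuousMap η)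
        (fun i => P (η.face i)) (hP.compat η) (hbot η) (tau_pos q) (tau_le_one q) (hstat η)
      refine ⟨G, hG0, hGs, fun t s hs => hGst t s ((tau_lt_succ q).le.trans hs), fun t ht => ?_,
        fun h => absurd h hη, fun h => absurd h hA⟩
      have ht' : t ∈ stdBoundary (q + 1) := by
        rw [stdBoundary_eq_stdSkel]; exact stdSkel_mono _ (by omega) ht
      obtain ⟨i, hi⟩ := ht'
      obtain ⟨z, rfl⟩ := exists_stdFace_eq i t hi
      rw [hGs]
      exact hP.skel _ z ((stdFace_mem_stdSkel_iff i z).1 ht)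
  choose P' hB' hS' hSt' hT' hC' hA' using key
  refine ⟨P', ⟨hB', fun η i => ?_, hT', hC', hA', hSt', EilenbergRetraction.compatible_faces_succ P' P hS'⟩, hS'⟩
  -- the vertices of the lid are at `x₀`: they lie on the faces
  obtain ⟨j, l, hjl⟩ := exists_vertex_eq_stdFace i
  rw [← hjl, hS', hP.vert]

end RelEilenbergRetraction

/-! ### The tower and the retraction -/

open SingularSimplex in
/-- **Relative Eilenberg retractions exist for `m`-connected pairs** — discharge of the named fact
`nonempty_relEilenbergRetraction` (Spanier, *Algebraic Topology* (1981), Ch. 7 §4, Thm. 8, by the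
inductive construction of its proof, p. 393, run inside `A` first). With `X` and `A` path connected
and `π_j(X, A, b) = 0` for `1 ≤ j ≤ m` and all `b`, the levels `RelEilenbergRetraction.exists_level_zero`
/ `RelEilenbergRetraction.exists_level_succ` can be chosen one dimension at a time (recursion on
`q`), giving Spanier's homotopies `P(σ)` in all dimensions; their end maps `σ ↦ σ̄ = P(σ)(·, 1)`
commute with the faces by (c), are relative Eilenberg simplices by (b), fix the relative Eilenberg
simplices, and send simplices of `A` to simplices of `A` by (A): a `RelEilenbergRetraction X A x₀ m`.
[cite: Spanier1981, Ch. 7 §4 Thm. 8] -/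
theorem nonempty_relEilenbergRetraction_holds : nonempty_relEilenbergRetraction.{u} := by
  intro X _ _ A _ m hπ x₀
  -- Spanier's tower `P(σ)`: a level at a time, by recursion on the dimension
  let T := fun q : ℕ =>
    Nat.rec (motive := fun q => {P : SingularSimplex X q → C(StdSimplex q × I, X) //
        RelEilenbergRetraction.LevelGood A (x₀ : X) m q P})
      ⟨(RelEilenbergRetraction.exists_level_zero x₀ m).choose,
        (RelEilenbergRetraction.exists_level_zero x₀ m).choose_spec⟩
      (fun q s => ⟨(RelEilenbergRetraction.exists_level_succ hπ s.1 s.2).choose,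
        (RelEilenbergRetraction.exists_level_succ hπ s.1 s.2).choose_spec.1⟩) q
  -- (c): consecutive levels are compatible with the faces
  have hF : ∀ (q : ℕ) (η : SingularSimplex X (q + 1)) (i : Fin (q + 2)) (t : StdSimplex q) (s : I),
      (T (q + 1)).1 η (stdFace i t, s) = (T q).1 (η.face i) (t, s) :=
    fun q => (RelEilenbergRetraction.exists_level_succ hπ (T q).1 (T q).2).choose_spec.2
  refine ⟨{ ρ := fun {q} η => ofMap ⟨fun t => (T q).1 η (t, 1),
              ((T q).1 η).continuous.comp (continuous_id.prodMk continuous_const)⟩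
            face_ρ := fun {q} η i => ?_
            isRelEilenberg_ρ := fun {q} η => ⟨fun t ht => ?_, fun i => ?_⟩
            ρ_eq_self := fun {q} η hη => ?_
            range_ρ_subset := fun {q} η hη => ?_ }⟩
  · -- `σ̄⁽ⁱ⁾ = σ⁽ⁱ⁾‾` by (c)
    rw [ofMap_face]
    congr 1
    ext t
    exact hF q η i t 1
  · -- `σ̄` maps the `m`-skeleton into `A` by (b)
    rw [toContinuousMap_ofMap]
    exact (T q).2.skel η t ht
  · -- `σ̄` sends the vertices to `x₀` by (b)
    rw [toContinuousMap_ofMap]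
    exact (T q).2.vert η i
  · -- `σ̄ = σ` for relative Eilenberg `σ`: its homotopy is constant
    conv_rhs => rw [← ofMap_toContinuousMap η]
    congr 1
    ext t
    exact (T q).2.const η hη t 1
  · -- `σ̄ ⊆ A` for `σ ⊆ A` by (A)
    rintro _ ⟨t, rfl⟩
    rw [toContinuousMap_ofMap]
    exact (T q).2.inA η hη t 1

end Literature.AlgebraicTopology.SingularHomology

end
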